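import Literature.AlgebraicGeometry.HodgeTheory.NoTypeIVTimesCMInvariance
import Literature.AlgebraicGeometry.HodgeTheory.HodgeClassesProductSpanTypedCriterion
import Literature.AlgebraicGeometry.HodgeTheory.RealSl2BlocksTimesCMProductSpan
import Literature.AlgebraicGeometry.HodgeTheory.NoTypeIVFactorProductsHodgeConjecture
import HarnessLib

/-!
# `HodgeClassesProductSpan A C` for EVERY `A` without factor of type IV and `C` of CM type — discharge of the named fact `Lombardo2016_hodgeClassesProductSpan` (Lombardo 2016 Lemma 3.4 / Moonen–Zarhin 1999 (3.1): `Hg(A × C) = Hg(A) × Hg(C)`, so the Hodge ring of `A × C` is generated by the factors)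

Family `hodge`, layer `Literature/AlgebraicGeometry/HodgeTheory`. Research context: cell `pub-hodge-ring2`
(HONEST FRAMING: research route conditional on HC_CM; not a corollary; Q11.4-sentence-2 already refuted in
dim ≥ 3), Literature lane, programme R5 («no type IV × CM»). UNCONDITIONAL; theorems only, no definition, no
NEW named fact; it PROVES the tree's named fact

* `HodgeTheory.Lombardo2016_hodgeClassesProductSpan :
    ∀ A C, HasNoTypeIVFactor A → Milne1999.IsOfCMType C → HodgeClassesProductSpan A C`

of `HodgeTheory/HodgeGroupProductCMFactor.lean` (there vendored as `def … : Prop` with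
`[cite: Lombardo2016, Lemma 3.4 (p. 1229)]`, the binder `hL` of the whole product lane) as the theorem
`Lombardo2016_hodgeClassesProductSpan_holds`. No step towards a summit statement beyond the published
theorem it formalizes (HC_CM stays a hypothesis wherever it occurs below).

PRINTED RESULT. D. Lombardo, Ann. Inst. Fourier **66** (2016), Lemma 3.4 (p. 1229; Lemma 35 of arXiv:1402.1478):
«Suppose `B` is of CM type and `A_K̄` has no simple factor of type IV. Then we have `H(A × B) ≅ H(A) × H(B)`»;
B. Moonen, Yu. Zarhin, Math. Ann. **315** (1999) §3 (3.1): `Hg(X₁ × X₂) = Hg(X₁) × Hg(X₂)` fails «if and only if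
for some `m` and `n` the Hodge ring `B(X₁^m × X₂^n)` is not generated by the elements coming from `B(X₁^m)` and
`B(X₂^n)`» — so here every Hodge class on `A × C` (indeed on `B × Z` for `B` with slots over `A`, `Z` with slots
over `C`) is a sum of exterior products of Hodge classes of the factors.

PROOF (assembled from the tree). §1 EVALUATION `wordEval_mem_span_typed_cup_pureType_of_eq_zero_off_balanced`:
a coefficient function on words in two-sorted Hodge-adapted letters (`A`-letters of types `(1,0)`/`(0,1)` pulled
back along `f₁`, `C`-letters along `f₂`) that VANISHES off the `A`-kind-balanced words evaluates into the span of
the classes `f₁^* d ⌣ f₂^* μ` with `d` of type `(l,l)` and `μ` of pure type: word by word, split the positions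
into `A`- and `C`-positions (`exists_leftSplit`), shuffle (`cupPowOne_sumElim_eq_sign_smul_cupProduct`, the sign
of the shuffle), and read the types of the two monomials (`isOfHodgeType_cupPowOne`; balanced ⟹ `(l,l)`). §2
ASSEMBLY `hodgeClassesProductSpan_of_avSlots_of_hasNoTypeIVFactor`: the invariance theorem
`AVSlots.exists_coeff_eq_zero_off_balanced_of_prod_noTypeIV_cmType` (`NoTypeIVTimesCMInvariance`: the Lie step
«`Hg(A × C) ∋` the circle `Θ_A ⊕ 0`», perfectness of the corner algebra from Deligne I 3.6 and «no type IV») for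
the slot structure `AVSlots.prodLift` on `B × Z`, then §1, then the typed Künneth criterion
`mem_span_hodgeProductClasses_of_mem_span_pureType` (`HodgeClassesProductSpanTypedCriterion`: rationality of the
`B`-side classes recovered from the rationality of `c`). §3 the discharge and the binder-free rows of the product
lane (`hodgeConjectureFor_prod_of_cmHodgeHypothesis`, `…_iff_…`, `forall_prod_cmType_iff_cmHodgeHypothesis` with
`hL := Lombardo2016_hodgeClassesProductSpan_holds`; HC_CM remains an explicit hypothesis).

## References

* [Lombardo2016] D. Lombardo, Ann. Inst. Fourier 66 (2016), Lemma 3.4 (p. 1229) = arXiv:1402.1478 Lemma 35.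
  [cite: Lombardo2016, Lemma 3.4 (p. 1229)]
* [MoonenZarhin1999LowDim] B. Moonen, Yu. Zarhin, Math. Ann. 315 (1999), §1, §3 (3.1)–(3.2).
  [cite: MoonenZarhin1999LowDim, §3 (3.1)]
* [Deligne1982HodgeCycles] P. Deligne, LNM 900 (1982), I §3 Prop. 3.4, Prop. 3.6. [cite: Deligne1982HodgeCycles, I §3 Prop. 3.4]
* [HatcherAT2002] A. Hatcher, *Algebraic Topology* (2002), §3.2 Prop. 3.10, Thm. 3.16. [cite: HatcherAT2002, §3.2 Thm. 3.16]
* [VoisinHodgeI2002] C. Voisin, *Hodge Theory I*, §7.1.1, §11.3.2 Thm. 11.38. [cite: VoisinHodgeI2002, §11.3.2 Thm. 11.38]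
* [Milne1999] J. S. Milne, Compositio 117 (1999), §7 p. 72 (the hypothesis HC_CM). [cite: Milne1999, §7 p. 72]
* [VoisinHodgeII2003] C. Voisin, *Hodge Theory II*, proof of Prop. 9.20. [cite: VoisinHodgeII2003, proof of Prop. 9.20 (first display)]
-/

noncomputable section

open scoped TensorProduct
open CategoryTheory Module MonoidalCategory CartesianMonoidalCategory

namespace Literature.AlgebraicGeometry.HodgeTheory

open Literature.AlgebraicTopology.SingularHomology
open Literature.AlgebraicGeometry.Motives (IsSmoothProjective AbelianVariety bettiCohomology
  ofRatClassBaseChange ComplexPoints)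
open Literature.Barriers.HodgeConjecture
open Literature.RepresentationTheory.GeneralLinear

/-! ### §1 Evaluation of coefficient functions vanishing off the `A`-kind-balanced words -/

section Evaluation

variable {B Z X : AbelianVariety ℂ} {n : ℕ}

/-- The two cardinalities of a left/right split add up to the number of positions. [folklore] -/
private theorem card_isLeft_add_card_not_isLeft' {d : ℕ} {T P : Type*} (col : Fin d → T ⊕ P) :
    Fintype.card {t // (col t).isLeft = true} + Fintype.card {t // ¬ (col t).isLeft = true} = d := by
  classical
  rw [Fintype.card_subtype_compl, Nat.add_sub_cancel' (Fintype.card_subtype_le _), Fintype.card_fin]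

/-- **A monomial in Hodge-adapted degree-one letters has a pure type**: `(r₀, r₁)` = the numbers of letters of
kind `0` (type `(1,0)`) and of kind `1` (type `(0,1)`) (`isOfHodgeType_cupPowOne`; the empty monomial `1` is of
type `(0,0)`). [cite: VoisinHodgeI2002, §11.3.2 Thm. 11.38] -/
theorem isOfHodgeType_cupPowOne_of_kinds {L : Type*} (x : L × Fin 2 → complexBetti Z.X 1)
    (hx0 : ∀ jr, jr.2 = 0 → IsOfHodgeType Z.dim Z.X 1 1 0 (x jr))
    (hx1 : ∀ jr, jr.2 = 1 → IsOfHodgeType Z.dim Z.X 1 0 1 (x jr)) {r : ℕ} (w : Fin r → L × Fin 2) :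
    IsOfHodgeType Z.dim Z.X r (∑ t, if (w t).2 = 0 then 1 else 0) (∑ t, if (w t).2 = 0 then 0 else 1)
      (cupPowOne ℂ (ComplexPoints Z.X) r (fun t => x (w t))) := by
  have hZ : IsSmoothProjective Z.dim Z.X := Motives.AbelianVariety.isSmoothProjective_holds
  rcases Nat.eq_zero_or_pos r with rfl | hr
  · simp only [Finset.univ_eq_empty, Finset.sum_empty]
    exact isOfHodgeType_zero_zero_of_degree_zero hZ _
  · refine isOfHodgeType_cupPowOne hZ hr (fun t => x (w t)) _ _ fun t => ?_
    by_cases h0 : (w t).2 = 0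
    · rw [if_pos h0, if_pos h0]; exact hx0 _ h0
    · have h1 : (w t).2 = 1 := by
        have h01 : ∀ r' : Fin 2, r' ≠ 0 → r' = 1 := by decide
        exact h01 _ h0
      rw [if_neg h0, if_neg h0]; exact hx1 _ h1

/-- The numbers of letters of the two kinds add up to the length. [folklore] -/
private theorem sum_kinds_add {L : Type*} {r : ℕ} (w : Fin r → L × Fin 2) :
    (∑ t, if (w t).2 = 0 then 1 else 0 : ℕ) + (∑ t, if (w t).2 = 0 then 0 else 1 : ℕ) = r := by
  rw [← Finset.sum_add_distrib]
  have h2 : ∀ t : Fin r, ((if (w t).2 = 0 then 1 else 0) + (if (w t).2 = 0 then 0 else 1) : ℕ) = 1 :=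
    fun t => by split_ifs <;> rfl
  simp only [h2, Finset.sum_const, Finset.card_univ, Fintype.card_fin, smul_eq_mul, mul_one]

/-- **Balanced monomials have type `(l,l)`**: if the kind weights `+1` (kind `0`) / `-1` (kind `1`) of a word add
up to `0`, the two kind counts agree. [folklore] -/
private theorem kinds_eq_of_balanced {L : Type*} {r : ℕ} (w : Fin r → L × Fin 2)
    (hbal : ∑ t, (if (w t).2 = 0 then (1 : ℂ) else -1) = 0) :
    (∑ t, if (w t).2 = 0 then 1 else 0 : ℕ) = (∑ t, if (w t).2 = 0 then 0 else 1 : ℕ) := by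
  have hre : ∑ t, ((if (w t).2 = 0 then (1 : ℂ) else 0) - (if (w t).2 = 0 then (0 : ℂ) else 1)) =
      ∑ t, (if (w t).2 = 0 then (1 : ℂ) else -1) :=
    Finset.sum_congr rfl fun t _ => by split_ifs <;> norm_num
  have h : ((∑ t, if (w t).2 = 0 then 1 else 0 : ℕ) : ℂ) - ((∑ t, if (w t).2 = 0 then 0 else 1 : ℕ) : ℂ) = 0 := by
    push_cast
    rw [← Finset.sum_sub_distrib, hre, hbal]
  exact_mod_cast sub_eq_zero.1 h

/-- **EVALUATION (the invariants of `Hg(A) × 1` in `H(B) ⊗ H(Z)` are (type-`(l,l)` classes of `B`) ⊗ (classes of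
`Z`), letter by letter).** Let the letters of `X` be `A`-letters `f₁^* xA_{(j,τ)}^r` (places `inl τ`; `xA^0` of
type `(1,0)`, `xA^1` of type `(0,1)` on `B`) and `C`-letters `f₂^* y_{(j,i)}^r` (places `inr i`; same types on `Z`).
If a coefficient function `a` on words of length `2p` VANISHES at every word whose `A`-letters are not
kind-balanced, then `∑_w a(w) · x_w` is a `ℂ`-combination of classes `f₁^* d ⌣ f₂^* μ` with `d` a monomial of type
`(l,l)` on `B` (`2l` `A`-letters) and `μ` a monomial of pure type on `Z`: word by word, split the positions
(`exists_leftSplit`), shuffle the iterated product (`cupPowOne_sumElim_eq_sign_smul_cupProduct`), read the types.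
[cite: MoonenZarhin1999LowDim, §3 (3.1)] [cite: HatcherAT2002, §3.2 Prop. 3.10] [cite: VoisinHodgeI2002, §11.3.2 Thm. 11.38] -/
theorem wordEval_mem_span_typed_cup_pureType_of_eq_zero_off_balanced (f₁ : X ⟶ B) (f₂ : X ⟶ Z)
    {TA P : Type*} [Fintype TA] [Fintype P]
    (xA : (Fin n × TA) × Fin 2 → complexBetti B.X 1) (y : (Fin n × P) × Fin 2 → complexBetti Z.X 1)
    (hxA0 : ∀ jr, jr.2 = 0 → IsOfHodgeType B.dim B.X 1 1 0 (xA jr))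
    (hxA1 : ∀ jr, jr.2 = 1 → IsOfHodgeType B.dim B.X 1 0 1 (xA jr))
    (hy0 : ∀ jr, jr.2 = 0 → IsOfHodgeType Z.dim Z.X 1 1 0 (y jr))
    (hy1 : ∀ jr, jr.2 = 1 → IsOfHodgeType Z.dim Z.X 1 0 1 (y jr))
    {p : ℕ} {a : (Fin (2 * p) → (Fin n × (TA ⊕ P)) × Fin 2) → ℂ}
    (ha : ∀ (U : Fin (2 * p) → Fin n × (TA ⊕ P)) (η : Fin (2 * p) → Fin 2),
      (∑ t, Sum.elim (fun _ : TA => if η t = 0 then (1 : ℂ) else -1) (fun _ : P => (0 : ℂ)) (U t).2) ≠ 0 →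
      a (fun t => (U t, η t)) = 0) :
    wordEval (cupPowOneAlt ℂ (ComplexPoints X.X) (2 * p))
      (fun jr : (Fin n × (TA ⊕ P)) × Fin 2 => Sum.elim
        (fun τ => complexBetti.map f₁.hom.hom.hom 1 (xA ((jr.1.1, τ), jr.2)))
        (fun i => complexBetti.map f₂.hom.hom.hom 1 (y ((jr.1.1, i), jr.2))) jr.1.2) a ∈
      Submodule.span ℂ {z : complexBetti X.X (2 * p) | ∃ (i j : ℕ) (hij : i + j = 2 * p)
        (d : complexBetti B.X i) (μ : complexBetti Z.X j),
        (∃ l, 2 * l = i ∧ IsOfHodgeType B.dim B.X i l l d) ∧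
        (∃ r₀ r₁, r₀ + r₁ = j ∧ IsOfHodgeType Z.dim Z.X j r₀ r₁ μ) ∧
        z = cupProduct hij (complexBetti.map f₁.hom.hom.hom i d) (complexBetti.map f₂.hom.hom.hom j μ)} := by
  classical
  rw [wordEval_apply]
  refine Submodule.sum_mem _ fun w _ => ?_
  by_cases haw : a w = 0
  · rw [haw, zero_smul]; exact Submodule.zero_mem _
  refine Submodule.smul_mem _ _ ?_
  -- the word is `A`-kind balanced
  have hbal : ∑ t, Sum.elim (fun _ : TA => if (w t).2 = 0 then (1 : ℂ) else -1) (fun _ : P => (0 : ℂ)) (w t).1.2 = 0 := by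
    by_contra hne
    exact haw (ha (fun t => (w t).1) (fun t => (w t).2) hne)
  -- the two-sorted colouring of the positions and its left/right split
  set col : Fin (2 * p) → TA ⊕ P := fun t => (w t).1.2 with hcol
  set m := Fintype.card {t // (col t).isLeft = true} with hm
  set r := Fintype.card {t // ¬ (col t).isLeft = true} with hr
  have hmr : m + r = 2 * p := card_isLeft_add_card_not_isLeft' col
  obtain ⟨φ, τA, iC, hAcol, hCcol⟩ := exists_leftSplit col hm.symm hr.symm
  -- the `A`-part and the `C`-part of the word
  set wA : Fin m → (Fin n × TA) × Fin 2 := fun a' =>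
    (((w (φ.symm (Sum.inl a'))).1.1, τA a'), (w (φ.symm (Sum.inl a'))).2) with hwA
  set wC : Fin r → (Fin n × P) × Fin 2 := fun b' =>
    (((w (φ.symm (Sum.inr b'))).1.1, iC b'), (w (φ.symm (Sum.inr b'))).2) with hwC
  have hword : ((fun jr : (Fin n × (TA ⊕ P)) × Fin 2 => Sum.elim
        (fun τ => complexBetti.map f₁.hom.hom.hom 1 (xA ((jr.1.1, τ), jr.2)))
        (fun i => complexBetti.map f₂.hom.hom.hom 1 (y ((jr.1.1, i), jr.2))) jr.1.2) ∘ w) =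
      fun t => Sum.elim (fun a' => complexBetti.map f₁.hom.hom.hom 1 (xA (wA a')))
        (fun b' => complexBetti.map f₂.hom.hom.hom 1 (y (wC b'))) (φ t) := by
    funext t
    obtain ⟨s, rfl⟩ := φ.symm.surjective t
    rw [Function.comp_apply, Equiv.apply_symm_apply]
    rcases s with a' | b'
    · have h1 : (w (φ.symm (Sum.inl a'))).1.2 = Sum.inl (τA a') := hAcol a'
      simp only [h1, Sum.elim_inl, hwA]
    · have h1 : (w (φ.symm (Sum.inr b'))).1.2 = Sum.inr (iC b') := hCcol b'
      simp only [h1, Sum.elim_inr, hwC]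
  -- shuffle
  rw [hword, cupPowOneAlt_apply, cupPowOne_sumElim_eq_sign_smul_cupProduct ℂ φ hmr,
    ← Motives.complexBetti_map_cupPowOne, ← Motives.complexBetti_map_cupPowOne]
  refine Submodule.smul_mem _ _ (Submodule.subset_span ⟨m, r, hmr, _, _, ?_, ?_, rfl⟩)
  · -- the `A`-monomial is balanced, of type `(l,l)`
    have htyp := isOfHodgeType_cupPowOne_of_kinds xA hxA0 hxA1 wA
    have hbalA : ∑ a', (if (wA a').2 = 0 then (1 : ℂ) else -1) = 0 := by
      rw [← hbal, ← φ.symm.sum_comp, Fintype.sum_sum_type]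
      have hC0 : ∑ b', Sum.elim (fun _ : TA => if (w (φ.symm (Sum.inr b'))).2 = 0 then (1 : ℂ) else -1)
          (fun _ : P => (0 : ℂ)) (w (φ.symm (Sum.inr b'))).1.2 = 0 := by
        refine Finset.sum_eq_zero fun b' _ => ?_
        have h1 : (w (φ.symm (Sum.inr b'))).1.2 = Sum.inr (iC b') := hCcol b'
        rw [h1, Sum.elim_inr]
      rw [hC0, add_zero]
      refine Finset.sum_congr rfl fun a' _ => ?_
      have h1 : (w (φ.symm (Sum.inl a'))).1.2 = Sum.inl (τA a') := hAcol a'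
      rw [h1, Sum.elim_inl]
    have hk := kinds_eq_of_balanced wA hbalA
    have hsum := sum_kinds_add wA
    refine ⟨∑ t, (if (wA t).2 = 0 then 1 else 0 : ℕ), by omega, ?_⟩
    rw [hk] at htyp ⊢
    exact htyp
  · -- the `C`-monomial has a pure type
    exact ⟨_, _, sum_kinds_add wC, isOfHodgeType_cupPowOne_of_kinds y hy0 hy1 wC⟩

end Evaluation

/-! ### §2 `HodgeClassesProductSpan B Z` for `B` with slots over `A` without type IV and `Z` with slots over `C` of CM type -/

section ProductSpan

variable {A B C Z : AbelianVariety ℂ} {n : ℕ} {gB : Fin n → (B ⟶ A)} {gC : Fin n → (Z ⟶ C)}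

/-- **`HodgeClassesProductSpan B Z` (Lombardo's Lemma 3.4 / Moonen–Zarhin (3.1) for «no type IV × CM», PROVED
with slots).** Let `A` have no factor of type IV (`HasNoTypeIVFactor`), `C` be of CM type, `B` have `n` slots over
`A` and `Z` have `n` slots over `C` (e.g. `B = A^{N+1}`, `Z = C^{N+1}`). Then every rational class of Hodge type
`(p,p)` on `B × Z` is a `ℂ`-combination of exterior products `pr_B^* a ⌣ pr_Z^* b` of RATIONAL HODGE classes `a`
of `B` and `b` of `Z`. [cite: Lombardo2016, Lemma 3.4 (p. 1229)] [cite: MoonenZarhin1999LowDim, §3 (3.1)] -/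
theorem hodgeClassesProductSpan_of_avSlots_of_hasNoTypeIVFactor (hA4 : HasNoTypeIVFactor A)
    (hC : Milne1999.IsOfCMType C) (hgB : AVSlots A B gB) (hgC : AVSlots C Z gC) :
    HodgeClassesProductSpan B Z := by
  classical
  intro p c hcQ hc
  have hB : IsSmoothProjective B.dim B.X := Motives.AbelianVariety.isSmoothProjective_holds
  have hZ : IsSmoothProjective Z.dim Z.X := Motives.AbelianVariety.isSmoothProjective_holds
  have hXA : IsSmoothProjective A.dim A.X := Motives.AbelianVariety.isSmoothProjective_holds
  have hXC : IsSmoothProjective C.dim C.X := Motives.AbelianVariety.isSmoothProjective_holds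
  obtain ⟨hA, bA, h, cC, hbA0, hbA1, hcC0, hcC1, hmain⟩ :=
    (hgB.prodLift hgC).exists_coeff_eq_zero_off_balanced_of_prod_noTypeIV_cmType hA4 hC
  have hc' : IsOfHodgeType (B.prod Z).dim (B.prod Z).X (2 * p) p p c := by
    rw [Motives.AbelianVariety.dim_prod]; exact hc
  rcases Nat.eq_zero_or_pos p with rfl | hp
  · -- degree `0`: `c = s · 1 = pr_B^*(s · 1_B) ⌣ pr_Z^* 1_Z`
    have h1 : c ∈ Submodule.span ℂ {singularCohomology.one ℂ (ComplexPoints (B.X ⊗ Z.X))} :=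
      mem_divisorClassesSpan_zero (N := B.dim + Z.dim) (IsSmoothProjective.tensor_holds hB hZ) c
    obtain ⟨s, hs⟩ := Submodule.mem_span_singleton.1 h1
    refine mem_span_hodgeProductClasses_of_mem_span_pureType B Z hcQ hc (Submodule.subset_span ?_)
    refine ⟨0, 0, rfl, s • singularCohomology.one ℂ (ComplexPoints B.X), singularCohomology.one ℂ (ComplexPoints Z.X),
      ⟨0, rfl, isOfHodgeType_zero_zero_of_degree_zero hB _⟩,
      ⟨0, 0, rfl, isOfHodgeType_zero_zero_of_degree_zero hZ _⟩, ?_⟩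
    rw [← hs, map_smul, LinearMap.map_smul₂]
    erw [singularCohomology.map_one, singularCohomology.map_one, cupProduct_one]
  · obtain ⟨a, hca, hkill⟩ := hmain hp hcQ hc'
    -- the letters of `B × Z` over `A × C` are `pr_B^*`(letters of `B` over `A`) and `pr_Z^*`(letters of `Z` over `C`)
    set xA : (Fin n × Fin hA) × Fin 2 → complexBetti B.X 1 := fun jr =>
      complexBetti.map (gB jr.1.1).hom.hom.hom 1 (ofRatClassBaseChange (ComplexPoints A.X) 1 (bA (jr.1.2, jr.2)))
      with hxA
    set y : (Fin n × Fin h) × Fin 2 → complexBetti Z.X 1 := fun jr =>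
      complexBetti.map (gC jr.1.1).hom.hom.hom 1 (ofRatClassBaseChange (ComplexPoints C.X) 1 (cC (jr.1.2, jr.2)))
      with hy
    have hletters : (fun jr : (Fin n × (Fin hA ⊕ Fin h)) × Fin 2 => complexBetti.map
        (Motives.AbelianVariety.prodLift (Motives.AbelianVariety.fst B Z ≫ gB jr.1.1)
          (Motives.AbelianVariety.snd B Z ≫ gC jr.1.1)).hom.hom.hom 1
        (Sum.elim
          (fun i => complexBetti.map (Motives.AbelianVariety.fst A C).hom.hom.hom 1
            (ofRatClassBaseChange (ComplexPoints A.X) 1 (bA (i, jr.2))))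
          (fun i => complexBetti.map (Motives.AbelianVariety.snd A C).hom.hom.hom 1
            (ofRatClassBaseChange (ComplexPoints C.X) 1 (cC (i, jr.2))))
          jr.1.2)) =
        fun jr : (Fin n × (Fin hA ⊕ Fin h)) × Fin 2 => Sum.elim
          (fun i => complexBetti.map (Motives.AbelianVariety.fst B Z).hom.hom.hom 1 (xA ((jr.1.1, i), jr.2)))
          (fun i => complexBetti.map (Motives.AbelianVariety.snd B Z).hom.hom.hom 1 (y ((jr.1.1, i), jr.2)))
          jr.1.2 := by
      funext jr
      obtain ⟨⟨j, t⟩, κ⟩ := jr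
      rcases t with i | i
      · simp only [Sum.elim_inl, hxA]
        rw [complexBetti_map_map_hom, complexBetti_map_map_hom, Motives.AbelianVariety.prodLift_fst]
      · simp only [Sum.elim_inr, hy]
        rw [complexBetti_map_map_hom, complexBetti_map_map_hom, Motives.AbelianVariety.prodLift_snd]
    -- types of the letters
    have hxA0 : ∀ jr : (Fin n × Fin hA) × Fin 2, jr.2 = 0 → IsOfHodgeType B.dim B.X 1 1 0 (xA jr) := by
      rintro ⟨⟨j, i⟩, κ⟩ hκ
      change κ = 0 at hκ
      subst hκ
      exact (hbA0 i).map_of_isSmoothProjective hB hXA _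
    have hxA1 : ∀ jr : (Fin n × Fin hA) × Fin 2, jr.2 = 1 → IsOfHodgeType B.dim B.X 1 0 1 (xA jr) := by
      rintro ⟨⟨j, i⟩, κ⟩ hκ
      change κ = 1 at hκ
      subst hκ
      exact (hbA1 i).map_of_isSmoothProjective hB hXA _
    have hy0 : ∀ jr : (Fin n × Fin h) × Fin 2, jr.2 = 0 → IsOfHodgeType Z.dim Z.X 1 1 0 (y jr) := by
      rintro ⟨⟨j, i⟩, κ⟩ hκ
      change κ = 0 at hκ
      subst hκ
      exact (hcC0 i).map_of_isSmoothProjective hZ hXC _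
    have hy1 : ∀ jr : (Fin n × Fin h) × Fin 2, jr.2 = 1 → IsOfHodgeType Z.dim Z.X 1 0 1 (y jr) := by
      rintro ⟨⟨j, i⟩, κ⟩ hκ
      change κ = 1 at hκ
      subst hκ
      exact (hcC1 i).map_of_isSmoothProjective hZ hXC _
    -- evaluate and feed the typed criterion
    have hmem := wordEval_mem_span_typed_cup_pureType_of_eq_zero_off_balanced
      (Motives.AbelianVariety.fst B Z) (Motives.AbelianVariety.snd B Z) xA y hxA0 hxA1 hy0 hy1 hkill
    rw [← hletters, hca] at hmem
    refine mem_span_hodgeProductClasses_of_mem_span_pureType B Z hcQ hc (Submodule.span_mono ?_ hmem)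
    rintro z ⟨i, j, hij, d, μ, hd, hμ, rfl⟩
    exact ⟨i, j, hij, d, μ, hd, hμ, rfl⟩

/-- **`HodgeClassesProductSpan A C` for every `A` without factor of type IV and every `C` of CM type** (one slot
on each side) — Lombardo 2016 Lemma 3.4 with Moonen–Zarhin 1999 (3.1), `m = n = 1`, PROVED.
[cite: Lombardo2016, Lemma 3.4 (p. 1229)] [cite: MoonenZarhin1999LowDim, §3 (3.1)] -/
theorem hodgeClassesProductSpan_of_hasNoTypeIVFactor_of_isOfCMType (hA4 : HasNoTypeIVFactor A)
    (hC : Milne1999.IsOfCMType C) : HodgeClassesProductSpan A C :=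
  hodgeClassesProductSpan_of_avSlots_of_hasNoTypeIVFactor hA4 hC (avSlots_self A) (avSlots_self C)

/-- **DISCHARGE of the named fact `Lombardo2016_hodgeClassesProductSpan`** (`HodgeGroupProductCMFactor.lean`;
the binder `hL` of the product lane): for every complex abelian variety `A` without simple factor of type IV
and every `C` of CM type, the rational `(p,p)`-classes of `A × C` are spanned by exterior products of rational
Hodge classes of `A` and of `C`. [cite: Lombardo2016, Lemma 3.4 (p. 1229)] [cite: MoonenZarhin1999LowDim, §3 (3.1)] -/
theorem Lombardo2016_hodgeClassesProductSpan_holds : Lombardo2016_hodgeClassesProductSpan :=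
  fun _ _ hA4 hC => hodgeClassesProductSpan_of_hasNoTypeIVFactor_of_isOfCMType hA4 hC

/-- **All powers**: `HodgeClassesProductSpan (A^{M+1}) (C^{N+1})` for `A` without factor of type IV and `C` of CM
type (Moonen–Zarhin (3.1) for all `m`, `n`: no type IV and CM type are stable under powers,
`HasNoTypeIVFactor.powSucc`, `isOfCMType_powSucc`). [cite: MoonenZarhin1999LowDim, §3 (3.1)]
[cite: Lombardo2016, Lemma 3.4 (p. 1229)] -/
theorem hodgeClassesProductSpan_powSucc_powSucc_of_hasNoTypeIVFactor (hA4 : HasNoTypeIVFactor A)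
    (hC : Milne1999.IsOfCMType C) (M N : ℕ) : HodgeClassesProductSpan (A.powSucc M) (C.powSucc N) :=
  hodgeClassesProductSpan_of_hasNoTypeIVFactor_of_isOfCMType (hA4.powSucc M) (isOfCMType_powSucc hC N)

end ProductSpan

/-! ### §3 The product lane without the binder `hL` (HC_CM stays an explicit hypothesis) -/

section Consequences

variable {A C : AbelianVariety ℂ}

/-- **HC(`A × C`) ⟺ HC(`A`) ∧ HC(`C`)** for `A` without factor of type IV and `C` of CM type — the tree's
`hodgeConjectureFor_prod_iff_of_lombardo` with the span fact DISCHARGED (exactness: Fulton §19.2 slice argument;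
sufficiency: exterior products of algebraic classes). [cite: Lombardo2016, Lemma 3.4 (p. 1229)]
[cite: VoisinHodgeII2003, proof of Prop. 9.20 (first display)] -/
theorem hodgeConjectureFor_prod_iff_of_hasNoTypeIVFactor_of_isOfCMType (A C : AbelianVariety ℂ)
    (hA4 : HasNoTypeIVFactor A) (hCt : Milne1999.IsOfCMType C) :
    HodgeConjectureFor (A.prod C).dim (A.prod C).X ↔
      HodgeConjectureFor A.dim A.X ∧ HodgeConjectureFor C.dim C.X :=
  hodgeConjectureFor_prod_iff_of_lombardo Lombardo2016_hodgeClassesProductSpan_holds A C hA4 hCt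

/-- **HC_CM ⟹ HC(`A × C`) for `A` without factor of type IV satisfying HC and `C` of CM type** — the frame
`hodgeConjectureFor_prod_of_cmHodgeHypothesis` of the product lane with `hL` DISCHARGED (HONEST FRAMING: research
route conditional on HC_CM; not a corollary; Q11.4-sentence-2 already refuted in dim ≥ 3; `hCM` is Milne's
per-variety HC_CM, an explicit hypothesis used once, at `C`). [cite: Lombardo2016, Lemma 3.4 (p. 1229)]
[cite: Milne1999, §7 p. 72] -/
theorem hodgeConjectureFor_prod_of_hasNoTypeIVFactor_of_cmHodgeHypothesis
    (hCM : ∀ Y : AbelianVariety ℂ, Milne1999.CMHodgeHypothesisAt Y) (A C : AbelianVariety ℂ)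
    (hA4 : HasNoTypeIVFactor A) (hCt : Milne1999.IsOfCMType C) (hA : HodgeConjectureFor A.dim A.X) :
    HodgeConjectureFor (A.prod C).dim (A.prod C).X :=
  hodgeConjectureFor_prod_of_cmHodgeHypothesis hCM Lombardo2016_hodgeClassesProductSpan_holds A C hA4 hCt hA

/-- **HC_CM ⟺ HC on every slice `{A₀ × C : C of CM type}`** for ONE fixed `A₀` without factor of type IV
satisfying HC — the tree's `forall_prod_cmType_iff_cmHodgeHypothesis` with `hL` DISCHARGED: on the class reached
by the Mumford–Tate / CM-factor line, HC_CM is EXACTLY the missing input (neither side asserted).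
[cite: Lombardo2016, Lemma 3.4 (p. 1229)] [cite: Milne1999, §7 p. 72] -/
theorem forall_prod_cmType_iff_cmHodgeHypothesis_of_hasNoTypeIVFactor (A₀ : AbelianVariety ℂ)
    (h₀4 : HasNoTypeIVFactor A₀) (h₀ : HodgeConjectureFor A₀.dim A₀.X) :
    (∀ C : AbelianVariety ℂ, Milne1999.IsOfCMType C → HodgeConjectureFor (A₀.prod C).dim (A₀.prod C).X) ↔
      ∀ C : AbelianVariety ℂ, Milne1999.CMHodgeHypothesisAt C :=
  forall_prod_cmType_iff_cmHodgeHypothesis Lombardo2016_hodgeClassesProductSpan_holds A₀ h₀4 h₀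

/-- **HC_CM ⟹ HC(`X^{N+1} × C`)** for `X` without factor of type IV with HC(`X^{N+1}`) and `C` of CM type — the
general power row of `NoTypeIVFactorProductsHodgeConjecture` with `hL` DISCHARGED.
[cite: MoonenZarhin1999LowDim, §1 and §3 (3.1)] [cite: Lombardo2016, Lemma 3.4 (p. 1229)] -/
theorem hodgeConjectureFor_powSucc_prod_of_hasNoTypeIVFactor_of_cmHodgeHypothesis
    (hCM : ∀ Y : AbelianVariety ℂ, Milne1999.CMHodgeHypothesisAt Y) (X C : AbelianVariety ℂ)
    (h4 : HasNoTypeIVFactor X) (hCt : Milne1999.IsOfCMType C) (N : ℕ)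
    (hX : HodgeConjectureFor (X.powSucc N).dim (X.powSucc N).X) :
    HodgeConjectureFor ((X.powSucc N).prod C).dim ((X.powSucc N).prod C).X :=
  hodgeConjectureFor_powSucc_prod_of_cmHodgeHypothesis hCM Lombardo2016_hodgeClassesProductSpan_holds X C h4 hCt N hX

end Consequences

end Literature.AlgebraicGeometry.HodgeTheory

end
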